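import Mathlib.LinearAlgebra.ExteriorAlgebra.Basic
import Mathlib.Data.Nat.Choose.Sum
import Mathlib.Data.Finset.Powerset
import Literature.MathematicalPhysics.QuantumLattice.GrassmannIntegralGaussianProofs
import HarnessLib

/-!
# Integrality of the Chern character of a line bundle on an abelian variety ([GLO01] Lemma 4.3.4.1)

Golyshev–Lunts–Orlov, *Mirror symmetry for abelian varieties*, J. Algebraic Geom. 10 (2001) 433–496
(arXiv math/9812003v2, PDF p. 16 L122 – p. 17 L8; held store text `paper:arxiv-math_9812003`, chunk p0011
L205–L237 — two materialisations of the same print), LEMMA 4.3.4.1: «For any line bundle `L` on an abelian variety `A` the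
Chern character `ch(L)` is integral, i.e belongs to `H*(A, ℤ)`.»  The printed proof: `ch(L) = exp(c₁(L))`, so one
must show that `c₁(L)^k / k!` is integral for every `k`; writing `c₁(L) = Σ_{i<j} d_{ij} xᵢ ∪ xⱼ` in a basis
`x₁, …, x_{2n}` of `H¹(A, ℤ)` (recall `H*(A, ℤ) = Λ* H¹(A, ℤ)`, [MumfordAV1970] §1), one gets
`c₁(L)^k = k! · Σ d_{i₁j₁}⋯d_{i_kj_k} x_{i₁} ∪ x_{j₁} ∪ ⋯ ∪ x_{i_k} ∪ x_{j_k}` (sum over `k` pairs `(i₁<j₁); …; (i_k<j_k)`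
with `(i₁, j₁, …, i_k, j_k) ⊂ (1, …, 2n)`, i.e. all `2k` indices distinct), «That proves this lemma and the
proposition» (by eye, arXiv v2 PDF p. 16 bottom – p. 17 top). The same lemma is the input of [GLO01] PROP. 4.3.4
(every exact equivalence `D^b(A) ⥲ D^b(B)` preserves integral cohomology).

## What is here (everything PROVED; no `def`, no named fact)

The ALGEBRAIC CONTENT of that proof, in the exterior-algebra model of `H*(A, ℤ)` used throughout the tree
(`ExteriorAlgebra R M`, `R` any commutative ring — the case of the lemma is `R = ℤ`, `M = H¹(A, ℤ)`):

* `sum_pow_eq_factorial_mul_sum_prod` — in a COMMUTATIVE ring, for elements `x i` with `x i * x i = 0`: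
  `(Σ_{i∈s} x i)^k = k! * Σ_{t ⊆ s, |t| = k} Π_{i∈t} x i` — the displayed formula of the printed proof, read in
  the commutative ring `H^{ev}(A, ℤ)` with `x_{(ij)} = d_{ij} xᵢ ∪ xⱼ`. It is recorded for fidelity to the print and is
  NOT used by the exterior-algebra theorems below (which cannot invoke a commutative-ring lemma directly).
* `exists_pow_eq_factorial_smul_of_mem_span` — for every `c` in the `R`-span of the decomposable 2-vectors
  `ι v * ι w` of `ExteriorAlgebra R M` and every `k`, there is `y` with `c ^ k = k! • y`; i.e. the divided powers
  `c^k / k!` — the homogeneous components of `exp(c)` — exist INSIDE `Λ_R(M)` (for `R = ℤ` and `M` free this is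
  exactly «`exp(c)` is integral»).  Proved by span induction: a decomposable `v ∧ w` squares to zero, the span is
  central, and divided powers of commuting elements add by Vandermonde (`C(k,m)·m!·(k−m)! = k!`).
* `exists_twoForm_pow_eq_factorial_smul` — the same for an explicit finite 2-form `Σ_p c_p • (ι u_p * ι v_p)`.
* `commute_of_mem_span_ιMulι` — the span of the decomposable 2-vectors is central. The two folklore helpers it
  rests on (`v ∧ w` central; `(v ∧ w)² = 0`) are NOT restated: they landed first in the tree's Grassmann-algebra file
  (`Literature.MathematicalPhysics.QuantumLattice.GrassmannAlgebra.commute_ι_mul_ι` / `ι_mul_ι_mul_self`), which is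
  imported and reused (gate dedup rule), odd as the topical import looks.

## What is NOT here

No abelian variety, line bundle or Chern character is constructed: the identification `H*(A, ℤ) = Λ* H¹(A, ℤ)`
with `c₁(L) ∈ Λ² H¹(A, ℤ)` ([MumfordAV1970] §1) is where a user plugs this in, exactly as the wedge-model files of the
tree do. Nothing here concerns any conjecture.
-/

namespace Literature.AlgebraicGeometry.AbelianVarieties

open Finset

section CommRing

variable {A : Type*} [CommRing A] {ι : Type*}

/-- **The displayed formula of [GLO01]'s proof of Lemma 4.3.4.1.** In a commutative ring, if every `x i`
(`i ∈ s`) squares to zero, then `(Σ_{i∈s} x i)^k = k! · Σ_{t ⊆ s, |t| = k} Π_{i∈t} x i` for every `k`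
(only square-free monomials survive in the multinomial expansion, each with coefficient `k!`).
Printed instance: `xₚ = d_{ij} · (xᵢ ∪ xⱼ)` indexed by pairs `p = (i<j)`, giving
`c₁(L)^k = k! Σ d_{i₁j₁}⋯d_{i_kj_k} (x_{i₁} ∪ x_{j₁} ∪ ⋯ ∪ x_{i_k} ∪ x_{j_k})` in `H^{ev}(A, ℤ)` — there the `k`-sets of
pairs with a repeated index contribute `0` as well (`xᵢ ∪ xᵢ = 0`), which is why the printed sum runs over index-disjoint
pairs only; in the abstract commutative setting below those terms are simply kept.
[cite: GolyshevLuntsOrlov2001MirrorAV, Lemma 4.3.4.1 (proof, displayed formula)] -/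
theorem sum_pow_eq_factorial_mul_sum_prod [DecidableEq ι] (s : Finset ι) (x : ι → A)
    (hsq : ∀ i ∈ s, x i * x i = 0) (k : ℕ) :
    (∑ i ∈ s, x i) ^ k = (k.factorial : A) * ∑ t ∈ s.powersetCard k, ∏ i ∈ t, x i := by
  induction s using Finset.induction_on generalizing k with
  | empty =>
    rcases k with _ | k
    · simp
    · have h : powersetCard (k + 1) (∅ : Finset ι) = ∅ := Finset.powersetCard_eq_empty.mpr (by simp)
      simp [h]
  | insert a s ha ih =>
    have hsq' : ∀ i ∈ s, x i * x i = 0 := fun i hi => hsq i (mem_insert_of_mem hi)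
    have haa : x a * x a = 0 := hsq a (mem_insert_self a s)
    rcases k with _ | k
    · simp
    rw [sum_insert ha, add_pow]
    -- only the terms `m = 0, 1` of the binomial expansion survive
    rw [sum_range_succ', sum_range_succ']
    have hvan : ∑ m ∈ range k, x a ^ (m + 1 + 1) * (∑ i ∈ s, x i) ^ (k + 1 - (m + 1 + 1)) *
        ((k + 1).choose (m + 1 + 1) : A) = 0 := by
      refine sum_eq_zero fun m _ => ?_
      rw [pow_succ, pow_succ, mul_assoc (x a ^ m), haa, mul_zero, zero_mul, zero_mul]
    rw [hvan, zero_add, pow_zero, one_mul, zero_add, pow_one, Nat.choose_zero_right, Nat.cast_one, mul_one,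
      Nat.sub_zero, Nat.choose_one_right, Nat.add_sub_cancel, ih hsq' k, ih hsq' (k + 1),
      powersetCard_succ_insert ha, sum_union (by
        rw [disjoint_iff_ne]
        rintro t ht _ ht' rfl
        obtain ⟨u, -, rfl⟩ := mem_image.mp ht'
        exact ha (mem_powersetCard.mp ht |>.1 (mem_insert_self a u))),
      sum_image (by
        intro u hu u' hu' h
        have hau : a ∉ u := fun h' => ha (mem_powersetCard.mp hu |>.1 h')
        have hau' : a ∉ u' := fun h' => ha (mem_powersetCard.mp hu' |>.1 h')
        rw [← erase_insert hau, ← erase_insert hau', h])]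
    have hprod : ∀ u ∈ s.powersetCard k, ∏ i ∈ insert a u, x i = x a * ∏ i ∈ u, x i := fun u hu =>
      prod_insert fun h' => ha (mem_powersetCard.mp hu |>.1 h')
    rw [sum_congr rfl hprod, ← mul_sum, Nat.factorial_succ, Nat.cast_mul, Nat.cast_succ]
    ring
end CommRing

section Exterior

open ExteriorAlgebra
open Literature.MathematicalPhysics.QuantumLattice (GrassmannAlgebra.commute_ι_mul_ι GrassmannAlgebra.ι_mul_ι_mul_self)

variable {R : Type*} [CommRing R] {M : Type*} [AddCommGroup M] [Module R M]

/-- Every element of the span of the decomposable 2-vectors is central in `Λ_R(M)`.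
[cite: BourbakiAlgebre1a3, Ch. III §7] -/
theorem commute_of_mem_span_ιMulι {c : ExteriorAlgebra R M}
    (hc : c ∈ Submodule.span R {z : ExteriorAlgebra R M | ∃ v w : M, z = ι R v * ι R w}) (z : ExteriorAlgebra R M) :
    Commute c z := by
  induction hc using Submodule.span_induction with
  | mem x hx => obtain ⟨v, w, rfl⟩ := hx; exact GrassmannAlgebra.commute_ι_mul_ι v w z
  | zero => exact Commute.zero_left z
  | add x y _ _ hx hy => exact hx.add_left hy
  | smul r x _ hx => exact hx.smul_left r

/-- **Divided powers of a 2-form exist integrally** — the algebraic content of [GLO01] LEMMA 4.3.4.1 «For any line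
bundle `L` on an abelian variety `A` the Chern character `ch(L)` is integral, i.e belongs to `H*(A, ℤ)`»: for every
`c` in the `R`-span of the decomposable 2-vectors of `Λ_R(M)` and every `k` there is `y ∈ Λ_R(M)` with
`c^k = k! • y`, i.e. the degree-`2k` component `c^k/k!` of `exp(c)` is defined over `R`. With `R = ℤ`,
`M = H¹(A, ℤ)`, `Λ_ℤ(M) = H*(A, ℤ)` ([MumfordAV1970] §1) and `c = c₁(L)` this is the printed lemma. Proof as printed
for a single `v ∧ w` (it squares to zero), then additivity of divided powers for commuting elements
(`C(k,m) · m! · (k−m)! = k!`) along the span.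
[cite: GolyshevLuntsOrlov2001MirrorAV, Lemma 4.3.4.1] -/
theorem exists_pow_eq_factorial_smul_of_mem_span {c : ExteriorAlgebra R M}
    (hc : c ∈ Submodule.span R {z : ExteriorAlgebra R M | ∃ v w : M, z = ι R v * ι R w}) (k : ℕ) :
    ∃ y : ExteriorAlgebra R M, c ^ k = k.factorial • y := by
  induction hc using Submodule.span_induction generalizing k with
  | mem x hx =>
    obtain ⟨v, w, rfl⟩ := hx
    rcases k with _ | _ | k
    · exact ⟨1, by simp⟩
    · exact ⟨ι R v * ι R w, by simp⟩
    · refine ⟨0, ?_⟩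
      rw [smul_zero, pow_succ, pow_succ, mul_assoc, GrassmannAlgebra.ι_mul_ι_mul_self, mul_zero]
  | zero =>
    rcases k with _ | k
    · exact ⟨1, by simp⟩
    · exact ⟨0, by simp⟩
  | add x z hx' _ hx hz =>
    classical
    choose a ha using hx
    choose b hb using hz
    refine ⟨∑ m ∈ range (k + 1), a m * b (k - m), ?_⟩
    rw [(commute_of_mem_span_ιMulι hx' z).add_pow k, smul_sum]
    refine sum_congr rfl fun m hm => ?_
    have hmk : m ≤ k := Nat.lt_succ_iff.mp (mem_range.mp hm)
    rw [ha m, hb (k - m), ← nsmul_eq_mul', smul_mul_assoc, mul_smul_comm, smul_smul, smul_smul,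
      ← Nat.choose_mul_factorial_mul_factorial hmk, mul_assoc]
  | smul r x _ hx =>
    obtain ⟨y, hy⟩ := hx k
    exact ⟨r ^ k • y, by rw [smul_pow, hy, smul_comm]⟩

/-- The same for an explicit finite 2-form `ω = Σ_{p∈s} c_p • (ι u_p * ι v_p)` (e.g. `c₁(L) = Σ d_{ij} xᵢ ∧ xⱼ`):
`ω^k = k! • y` for some `y ∈ Λ_R(M)`. [cite: GolyshevLuntsOrlov2001MirrorAV, Lemma 4.3.4.1] -/
theorem exists_twoForm_pow_eq_factorial_smul {κ : Type*} (s : Finset κ) (c : κ → R) (u v : κ → M) (k : ℕ) :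
    ∃ y : ExteriorAlgebra R M, (∑ p ∈ s, c p • (ι R (u p) * ι R (v p))) ^ k = k.factorial • y :=
  exists_pow_eq_factorial_smul_of_mem_span
    (Submodule.sum_mem _ fun p _ => Submodule.smul_mem _ _ (Submodule.subset_span ⟨u p, v p, rfl⟩)) k

end Exterior

end Literature.AlgebraicGeometry.AbelianVarieties
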